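/-
Copyright (c) 2026 the pub-hodgecm-mathlib formalisation cell (harness21).  Prover seat hodgecm-mathlib-K2E1-p10 (g6), Track B ∕ K2-LIT, h413 =
`stmt-HodgeConjecture-24833`, route `HCCMUnconditional`; R90-TF S8 «ContSpec-n½», (M) road RES-INT line 7 «PACKAGING» (census
`K2/K2E1-p10/g6/CENSUS-LINE7-Packaging.K2E1-p10-g6.md` d2e571fc812fd5b2, step (7b)).
-/
import Summits.HodgeConjecture.HodgeConjecture.Theorems.R90S8ResMidConstituentOfEquivariantMapU3   -- ★ (7a): `exists_simple_submodule_le_iSup_range_of_le_ker`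
import Literature.RepresentationTheory.Semisimple.SubrepresentationEquiv   -- ★ the `k[G]`-module dictionary: `Subrepresentation.asModuleEquiv`, `Representation.Equiv.ofAsModuleLinearEquiv`, `isIrreducible_toRepresentation_iff`
import Literature.NumberTheory.Automorphic.AdmissibleSubquotient   -- ★ `Representation.quotientRepAsModuleEquiv`, `Representation.IsSmooth.toRepresentation`
import Literature.NumberTheory.Automorphic.IrreducibleClassesConstituents   -- ★ `IrrClass.isConstituentOf_mk_of_injective`, `IrrClass.IsConstituentOf.of_subrepresentation`
import HarnessLib

/-!
# R90 · S8 «ContSpec-n½» — `R90S8ResMidConstituentOfIntertwinersU3`: RES-INT line 7 (7b) — a family of intertwining maps `Φ_i : I → ρ` KILLING a subrepresentation `K` with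
# `I ⧸ K` irreducible: every subrepresentation `P ≤ ρ` MEETING the span of the images CONTAINS an irreducible subrepresentation `Z ≅ I ⧸ K`; hence `⟦I ⧸ K⟧` is a
# constituent of `P` [BernsteinZelevinsky1976 §2.1; BushnellHenniart2006 §§1–2; Jacobson1989BasicAlgebraII §3.5; MoeglinWaldspurger1995 IV.1.11 (the use)]

Cell `pub/hodgecm-mathlib`, crux H413 = `stmt-HodgeConjecture-24833` (lane `--kind proof --supports stmt-HodgeConjecture-24833 --as helper`), route of record
`HCCMUnconditional`; programme R90-TF, section S8, the (M) socket road, RES-INT line 7.  THEOREMS ONLY (no `def`, no `instance`, no `notation`, no `sorry`); default heartbeats.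
CLOSES NO SOCKET.

THE USE (census d2e571fc812fd5b2 (2)–(4); ★ (7a) p864961).  At a non-split place `v`: `I := i_G(χ_{ξ,v})` (★ `cmPrincipalSeries L 3 v (cmXiTorusChar …)`), `K := K_v` ORIENT's maximal
proper subrepresentation (★ `Rogawski1990.KeysOrientation` (iii)), `I ⧸ K = πⁿ(ξ_v)` irreducible; `ρ :=` the `G_v`-representation on the smooth vectors of the residual block (`L²`, right
translation along `ι_v`), `P := P′^∞|_{G_v}`; `Φ_i x_v := Res (ι x_v φᵛ_i)` for finitely many away-from-`v` data `φᵛ_i` — intertwining (★ LIN p864683 + line 6 ★ p864700 at `g = ι_v(g_v)`)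
and KILLING `K_v` (★ KER p864667 `res_class_eq_zero_iff_rhoPsi_eq_zero` + FACT-N `M₋₁ (ι x_v φᵛ) = ιʷ (N_v x_v) (M₋₁ᵛ φᵛ)`, `N_v(K_v) = 0`: ★ p864847 + LH4-p10 + J-S8-FN (a)); `hmeet` = the
letter «`P′ ∩ Res(V_τ) ≠ 0`» ((7d): hDISC ★ + `hW1` + Peter–Weyl).  OUTPUT (§2): `∃ r : SmoothIrrep G_v, (IrrClass.mk r).IsConstituentOf P′^∞|_{G_v} ∧ Nonempty (r.ρ.Equiv (I ⧸ K))`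
— ONE quotient-shaped constituent of `P′` at `v`, which ★ hAF (one class per place, ★ `localConstituent_subsingleton_cm_three_of_AFA`) upgrades to ★ p864766's pin (QUOT-N) in (7c).

THE MATHEMATICS.  Read everything in `k[G]`-modules (Mathlib `Representation.asModule`, `Subrepresentation.asSubmodule`, `IntertwiningMap.equivLinearMapAsModule` — all the identity on
vectors): `Φ_i` become `k[G]`-linear maps `Φ'_i : I.asModule → ρ.asModule` with `K' := K.asSubmodule ≤ ker Φ'_i`, and `I.asModule ⧸ K' ≅ (I ⧸ K).asModule` (★ `quotientRepAsModuleEquiv`) is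
SIMPLE (Mathlib `irreducible_iff_isSimpleModule_asModule`).  By ★ (7a) `exists_simple_submodule_le_iSup_range_of_le_ker` the non-zero submodule `U := P' ⊓ ⨆ i, range Φ'_i` contains a
simple `Z' ≅ I.asModule ⧸ K'`; back through the dictionary (`Subrepresentation.ofSubmodule'`, ★ `isIrreducible_toRepresentation_iff`, ★ `Subrepresentation.asModuleEquiv`, ★
`Representation.Equiv.ofAsModuleLinearEquiv`) `Z := Z'` is an irreducible subrepresentation of `ρ` inside `P` with `Z ≅ I ⧸ K` (§1).  For smooth `ρ` on `V : Type`, `Z` is smooth (★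
`IsSmooth.toRepresentation`), so `⟨Z⟩ : SmoothIrrep G` and its class is a constituent of `P` along the injective inclusion `Z ↪ P` (★ `isConstituentOf_mk_of_injective`) (§2).
* §0 `asModuleEquiv_symm_mem_iSup_range` (the `k`-span of the images lies in the `k[G]`-span) · `apply_mem_iSup_range` (the `k`-span of the images is `G`-stable — lets a consumer NAME the
  span as a `Subrepresentation` literal).
* §1 **`exists_irreducible_le_equiv_quotientRep_of_meets_iSup_range`** (any field `k`).
* §2 **`exists_isConstituentOf_equiv_quotientRep_of_meets_iSup_range`** (`k = ℂ`, smooth `ρ` on `V : Type`; constituent of `P.toRepresentation`) · `…_of_meets_iSup_range'` (constituent of `ρ`).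
HONEST LABEL: HC_CM is proved only modulo the 7 printed citations (2 remaining named inputs: hLiu418 = `stmt-HodgeConjecture-24832`, h413 = `stmt-HodgeConjecture-24833`) until
rung 0 closes; generic representation theory, pays no socket; count-neutral.

## References
* [BernsteinZelevinsky1976] I. N. Bernstein, A. V. Zelevinsky, *Representations of the group GL(n,F) where F is a non-archimedean local field*, Russian Math. Surveys 31:3 (1976), §2.1.
* [BushnellHenniart2006] C. J. Bushnell, G. Henniart, *The Local Langlands Conjecture for GL(2)* (2006), §1.1–§2.
* [Jacobson1989BasicAlgebraII] N. Jacobson, *Basic Algebra II*, 2nd ed. (1989), §3.5.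
* [MoeglinWaldspurger1995] C. Mœglin, J.-L. Waldspurger, *Spectral Decomposition and Eisenstein Series* (1995), IV.1.11, V.3.13.
-/

set_option autoImplicit false
set_option linter.dupNamespace false  -- the mandated namespace `…HodgeConjecture.HodgeConjecture.R90.S8` repeats the summit's segment

noncomputable section

open scoped MonoidAlgebra
open Literature.RepresentationTheory.FiniteGroups Literature.RepresentationTheory.Semisimple Literature.NumberTheory.Automorphic

namespace Summit.HodgeConjecture.HodgeConjecture.R90.S8

universe u

/-! ## §0 The `k`-span of the images of a family of intertwining maps -/

section Span

variable {k : Type*} [Field k] {G : Type*} [Group G] {V : Type*} [AddCommGroup V] [Module k V] {ρ : Representation k G V}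
  {E : Type*} [AddCommGroup E] [Module k E] {I : Representation k G E} {ι : Type*}

/-- The `k`-span `⨆ i, range Φ_i` of the images of intertwining maps `Φ_i : I → ρ` lies in the `k[G]`-span of the images of the corresponding `k[G]`-linear maps
`I.asModule → ρ.asModule` (Mathlib `IntertwiningMap.equivLinearMapAsModule`, the identity on vectors). [folklore; BernsteinZelevinsky1976 §2.1] -/
theorem asModuleEquiv_symm_mem_iSup_range (Φ : ι → I.IntertwiningMap ρ) {x : V} (hx : x ∈ ⨆ i, LinearMap.range (Φ i).toLinearMap) :
    ρ.asModuleEquiv.symm x ∈ ⨆ i, LinearMap.range (Representation.IntertwiningMap.equivLinearMapAsModule I ρ (Φ i)) := by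
  refine Submodule.iSup_induction (fun i => LinearMap.range (Φ i).toLinearMap) (motive := fun y => ρ.asModuleEquiv.symm y ∈
      ⨆ i, LinearMap.range (Representation.IntertwiningMap.equivLinearMapAsModule I ρ (Φ i))) hx (fun i y hy => ?_) ?_ (fun y z hy hz => ?_)
  · obtain ⟨e, rfl⟩ := hy
    exact Submodule.mem_iSup_of_mem i ⟨I.asModuleEquiv.symm e, rfl⟩
  · rw [map_zero]
    exact Submodule.zero_mem _
  · rw [map_add]
    exact Submodule.add_mem _ hy hz

/-- The `k`-span `⨆ i, range Φ_i` of the images of intertwining maps `Φ_i : I → ρ` is `G`-stable — so `⟨⨆ i, LinearMap.range (Φ i).toLinearMap, apply_mem_iSup_range Φ⟩` is a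
`Subrepresentation ρ` (the span a consumer intersects `P′` with). [folklore; BernsteinZelevinsky1976 §2.1] -/
theorem apply_mem_iSup_range (Φ : ι → I.IntertwiningMap ρ) (g : G) {x : V} (hx : x ∈ ⨆ i, LinearMap.range (Φ i).toLinearMap) :
    ρ g x ∈ ⨆ i, LinearMap.range (Φ i).toLinearMap := by
  refine Submodule.iSup_induction (fun i => LinearMap.range (Φ i).toLinearMap) (motive := fun y => ρ g y ∈ ⨆ i, LinearMap.range (Φ i).toLinearMap) hx
    (fun i y hy => ?_) ?_ (fun y z hy hz => ?_)
  · obtain ⟨e, rfl⟩ := hy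
    refine Submodule.mem_iSup_of_mem i ⟨I g e, ?_⟩
    rw [Representation.IntertwiningMap.toLinearMap_apply, Representation.IntertwiningMap.toLinearMap_apply]
    exact Representation.IntertwiningMap.isIntertwining _ _ (Φ i) g e
  · rw [map_zero]
    exact Submodule.zero_mem _
  · rw [map_add]
    exact Submodule.add_mem _ hy hz

end Span

/-! ## §1 A subrepresentation meeting the span of the images contains an irreducible subrepresentation `≅ I ⧸ K` -/

section Algebra

variable {k : Type*} [Field k] {G : Type*} [Group G] {V : Type*} [AddCommGroup V] [Module k V] {ρ : Representation k G V}
  {E : Type*} [AddCommGroup E] [Module k E] {I : Representation k G E} {ι : Type*}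

/-- **A SUBREPRESENTATION MEETING THE SPAN OF THE IMAGES OF MAPS KILLING `K` CONTAINS AN IRREDUCIBLE SUBREPRESENTATION `≅ I ⧸ K`.**  `K ≤ I` a subrepresentation with `I ⧸ K` irreducible;
`Φ_i : I → ρ` intertwining maps with `K ≤ ker Φ_i`; `P ≤ ρ` a subrepresentation containing a non-zero vector of the span `⨆ i, range Φ_i`.  Then there is an IRREDUCIBLE subrepresentation
`Z ≤ P` of `ρ` with `Z ≅ I ⧸ K` (★ (7a) `exists_simple_submodule_le_iSup_range_of_le_ker` for the `k[G]`-modules, read back through the `k[G]`-dictionary).  («once `P′ ∩ Res(span) ≠ 0`,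
`P′|_{G_v}` contains an irreducible `G_v`-subrepresentation isomorphic to `i_G(χ_{ξ,v}) ⧸ K_v = πⁿ(ξ_v)`».)
[cite: Jacobson1989BasicAlgebraII, §3.5] [cite: BernsteinZelevinsky1976, §2.1] [cite: MoeglinWaldspurger1995, IV.1.11] -/
theorem exists_irreducible_le_equiv_quotientRep_of_meets_iSup_range (K : Subrepresentation I) (hK : K.quotientRep.IsIrreducible)
    (Φ : ι → I.IntertwiningMap ρ) (hker : ∀ i, K ≤ (Φ i).ker) (P : Subrepresentation ρ)
    (hmeet : ∃ x ∈ P, x ≠ 0 ∧ x ∈ ⨆ i, LinearMap.range (Φ i).toLinearMap) :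
    ∃ Z : Subrepresentation ρ, Z ≤ P ∧ Z.toRepresentation.IsIrreducible ∧ Nonempty (Z.toRepresentation.Equiv K.quotientRep) := by
  -- the `k[G]`-modules
  set Φ' : ι → (I.asModule →ₗ[k[G]] ρ.asModule) := fun i => Representation.IntertwiningMap.equivLinearMapAsModule I ρ (Φ i) with hΦ'
  haveI hK' : IsSimpleModule k[G] (I.asModule ⧸ K.asSubmodule) := by
    rw [Representation.irreducible_iff_isSimpleModule_asModule] at hK
    exact IsSimpleModule.congr (Representation.quotientRepAsModuleEquiv K)
  have hker' : ∀ i, K.asSubmodule ≤ LinearMap.ker (Φ' i) := fun i x hx => by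
    have h : (Φ i) x = 0 :=
      (Representation.IntertwiningMap.mem_ker I ρ (Φ i) x).1 (hker i ((Subrepresentation.mem_asSubmodule_iff (σ := K) (v := x)).1 hx))
    rw [LinearMap.mem_ker]
    exact h
  -- the non-zero submodule `U := P ⊓ span`
  obtain ⟨x, hxP, hx0, hxS⟩ := hmeet
  set U : Submodule k[G] ρ.asModule := P.asSubmodule ⊓ ⨆ i, LinearMap.range (Φ' i) with hU
  have hUle : U ≤ ⨆ i, LinearMap.range (Φ' i) := inf_le_right
  have hU0 : U ≠ ⊥ := by
    rw [Submodule.ne_bot_iff]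
    -- `x`, read in `ρ.asModule` (the identity `ρ.asModuleEquiv.symm`), lies in `U` and is non-zero
    exact ⟨x, Submodule.mem_inf.2 ⟨(Subrepresentation.mem_asSubmodule_iff (σ := P) (v := x)).2 hxP, asModuleEquiv_symm_mem_iSup_range Φ hxS⟩, hx0⟩
  -- ★ (7a): a simple `Z' ≤ U` with `Z' ≅ I.asModule ⧸ K'`
  obtain ⟨Z', hZ'U, hZ's, ⟨eZ⟩⟩ := exists_simple_submodule_le_iSup_range_of_le_ker K.asSubmodule hK' Φ' hker' U hUle hU0
  -- back through the dictionary
  refine ⟨Subrepresentation.ofSubmodule' Z', fun v hv => (Subrepresentation.mem_asSubmodule_iff (σ := P) (v := v)).1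
      (Submodule.mem_inf.1 (hZ'U ((Subrepresentation.mem_ofSubmodule'_iff (N := Z') (w := v)).1 hv))).1,
    (Subrepresentation.isIrreducible_toRepresentation_iff _).2 hZ's, ⟨Representation.Equiv.ofAsModuleLinearEquiv ?_⟩⟩
  exact (Subrepresentation.asModuleEquiv (Subrepresentation.ofSubmodule' Z')).trans (eZ.trans (Representation.quotientRepAsModuleEquiv K))

end Algebra

/-! ## §2 The class-level head: `⟦I ⧸ K⟧` is a constituent of `P` -/

section Constituent

variable {G : Type u} [Group G] [TopologicalSpace G] {V : Type} [AddCommGroup V] [Module ℂ V] {ρ : Representation ℂ G V}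
  {E : Type*} [AddCommGroup E] [Module ℂ E] {I : Representation ℂ G E} {ι : Type*}

/-- **`⟦I ⧸ K⟧` IS A CONSTITUENT OF EVERY SUBREPRESENTATION MEETING THE SPAN** (the (7b) head).  For a SMOOTH `ρ` on `V : Type`, `K ≤ I` with `I ⧸ K` irreducible, intertwining maps
`Φ_i : I → ρ` killing `K`, and a subrepresentation `P ≤ ρ` containing a non-zero vector of `⨆ i, range Φ_i`: there is an irreducible smooth representation `r` — an irreducible
subrepresentation `Z ≤ P`, smooth with `ρ` (★ `IsSmooth.toRepresentation`) — whose class is a constituent of `P` (along the injective inclusion `Z ↪ P`, ★ `isConstituentOf_mk_of_injective`)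
and which is isomorphic to `I ⧸ K` (§1).  («`P′|_{G_v}` has a constituent `≅ i_G(χ_{ξ,v}) ⧸ K_v = πⁿ(ξ_v)`, a QUOTIENT of the principal series» — ONE quotient-shaped constituent, which ★ hAF
one-class-per-place turns into ★ p864766's (QUOT-N).) [cite: BushnellHenniart2006, §2] [cite: BernsteinZelevinsky1976, §2.1] [cite: MoeglinWaldspurger1995, IV.1.11] -/
theorem exists_isConstituentOf_equiv_quotientRep_of_meets_iSup_range (hρ : ρ.IsSmooth) (K : Subrepresentation I) (hK : K.quotientRep.IsIrreducible)
    (Φ : ι → I.IntertwiningMap ρ) (hker : ∀ i, K ≤ (Φ i).ker) (P : Subrepresentation ρ)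
    (hmeet : ∃ x ∈ P, x ≠ 0 ∧ x ∈ ⨆ i, LinearMap.range (Φ i).toLinearMap) :
    ∃ r : SmoothIrrep G, (IrrClass.mk r).IsConstituentOf P.toRepresentation ∧ Nonempty (r.ρ.Equiv K.quotientRep) := by
  obtain ⟨Z, hZP, hZirr, ⟨eZ⟩⟩ := exists_irreducible_le_equiv_quotientRep_of_meets_iSup_range K hK Φ hker P hmeet
  -- the inclusion `Z ↪ P` as an injective intertwining map
  set f : Z.toRepresentation.IntertwiningMap P.toRepresentation :=
    { toLinearMap := Submodule.inclusion (show Z.toSubmodule ≤ P.toSubmodule from hZP)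
      isIntertwining' := fun g => LinearMap.ext fun _ => rfl } with hf
  have hfinj : Function.Injective f := Submodule.inclusion_injective (show Z.toSubmodule ≤ P.toSubmodule from hZP)
  exact ⟨{ V := Z.toSubmodule, ρ := Z.toRepresentation, isIrreducible := hZirr, isSmooth := hρ.toRepresentation Z },
    IrrClass.isConstituentOf_mk_of_injective hZirr (hρ.toRepresentation Z) f hfinj, ⟨eZ⟩⟩

/-- **`⟦I ⧸ K⟧` IS A CONSTITUENT OF `ρ`** when some subrepresentation (e.g. `⊤`, or `P′`) meets the span of the images of maps `I → ρ` killing `K` (§2 head ∘ ★ `IsConstituentOf.of_subrepresentation`).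
[cite: BushnellHenniart2006, §2] [cite: BernsteinZelevinsky1976, §2.1] -/
theorem exists_isConstituentOf_equiv_quotientRep_of_meets_iSup_range' (hρ : ρ.IsSmooth) (K : Subrepresentation I) (hK : K.quotientRep.IsIrreducible)
    (Φ : ι → I.IntertwiningMap ρ) (hker : ∀ i, K ≤ (Φ i).ker) (P : Subrepresentation ρ)
    (hmeet : ∃ x ∈ P, x ≠ 0 ∧ x ∈ ⨆ i, LinearMap.range (Φ i).toLinearMap) :
    ∃ r : SmoothIrrep G, (IrrClass.mk r).IsConstituentOf ρ ∧ Nonempty (r.ρ.Equiv K.quotientRep) := by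
  obtain ⟨r, hr, e⟩ := exists_isConstituentOf_equiv_quotientRep_of_meets_iSup_range hρ K hK Φ hker P hmeet
  exact ⟨r, hr.of_subrepresentation P, e⟩

end Constituent

end Summit.HodgeConjecture.HodgeConjecture.R90.S8

end
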